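import Literature.AnabelianGeometry.Anabelioids.ComponentsOrbits
import Literature.AnabelianGeometry.Anabelioids.AutOfEquivalence
import Mathlib.CategoryTheory.Galois.Topology
import HarnessLib

/-!
# Anabelioids: when does the image of `π₁` CONTAIN a stabiliser? — an orbit criterion ([SGA1] V §4–5)

Grothendieck, [SGA1] Exp. V §4–5 (Galois categories: `Aut F` is profinite, the stabilisers of points
of Galois objects form a basis of neighbourhoods of `1`, connected objects are the transitive
`Aut F`-sets) [cite: SGA1, Exp. V Cor. 5.7]; Mochizuki, *The geometry of anabelioids*, Publ. RIMS **40**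
(2004) §1.1 p. 10 (`π₁(X, β) := Aut(β)`, functoriality along a morphism)
[cite: MochizukiGeoAn2004, Def. 1.1.2(ii) p.10].

PROOF-ONLY file (no definition, no new named fact).  For a functor `Φ : C ⥤ D` out of a Galois
category `C`, a basepoint `F_D` of `D`, a basepoint `F_C` of `C` and an identification
`e : Φ ⋙ F_D ≅ F_C`, write `ι := Aut(e) ∘ π₁(Φ) : Aut F_D → Aut F_C` (the tree's `pi1Map` followed by
`Aut.autMulEquivOfIso`).  The image of `ι` is closed (`Aut F_D` is compact, `ι` is continuous), so an
automorphism `s` of `F_C` lies in it as soon as it can be APPROXIMATED on every fibre: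

* `mem_range_of_forall_exists_smul_eq` — if for every object `X` of `C` and every point `ξ ∈ F_C(X)`
  some `γ ∈ Aut F_D` has `ι(γ) · ξ = s · ξ`, then `s ∈ ι(Aut F_D)` (neighbourhood basis of stabilisers,
  Mathlib's `nhds_one_has_basis_stabilizers`);
* `stabilizer_le_range_of_forall_connected` — **the stabiliser `Stab(x)` of a point `x ∈ F_C(A)` is
  contained in `ι(Aut F_D)` as soon as, for every CONNECTED `Y` with a morphism `g : Y ⟶ A`, `Aut F_D`
  acts transitively (through `ι`) on the fibre of `F_C(g)` over `x`** (apply the first criterion to the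
  connected component of `X × A` through `(ξ, x)`: components are `Aut F_C`-orbits).

This is the abstract half of the `π₁`-surjectivity statement «`Stab_{Π_ℍ}(x) ≤ ι_ψ(Π_K)`» for the
restriction of a finite étale covering of semi-graphs of anabelioids to a preimage component
([SemiAnbd] Cor. 2.7 (i) proof, p. 30, "`ℋ′` injects into `𝒢′`"; abc-iut cell, layer L3, gap row
G-L3-R1-E3, abc-iut-L3-d3).  Also: `continuous_autMulEquivOfIso'` (change of basepoint is continuous,
all universes).  Nothing here takes a side on [IUTchIII] Cor. 3.12.
-/

namespace Literature.AnabelianGeometry.Anabelioids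

open CategoryTheory CategoryTheory.Limits CategoryTheory.PreGaloisCategory Topology

universe u₁ u₂ u₃ u₄ w

/-! ### Change of basepoint is continuous (all universes) -/

section Transport

variable {D : Type u₃} [Category.{u₄} D]

/-- Transport of automorphisms along an isomorphism of basepoints `e : F ≅ G` is continuous for
Mathlib's profinite topologies (it acts coordinatewise on `∏_B Aut (F B)`); universe-polymorphic
version of the tree's `Aut.continuous_autMulEquivOfIso`. [cite: MochizukiGeoAn2004, Def. 1.1.2(ii) p.10] -/
theorem continuous_autMulEquivOfIso' {F G : D ⥤ FintypeCat.{w}} (e : F ≅ G) :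
    Continuous (Aut.autMulEquivOfIso e) := by
  refine continuous_induced_rng.2 (continuous_pi fun B => ?_)
  have h1 : Continuous fun σ : Aut F => autEmbedding F σ B :=
    (continuous_apply B).comp continuous_induced_dom
  have h2 : Continuous fun τ : Aut (F.obj B) => Aut.autMulEquivOfIso (e.app B) τ :=
    continuous_of_discreteTopology
  have heq : (fun σ : Aut F => (autEmbedding G ∘ Aut.autMulEquivOfIso e) σ B) =
      fun σ => Aut.autMulEquivOfIso (e.app B) (autEmbedding F σ B) := by
    funext σ
    exact Iso.ext rfl
  rw [heq]
  exact h2.comp h1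

end Transport

/-! ### The orbit criterion -/

section Criterion

variable {C : Type u₁} [Category.{u₂} C] [GaloisCategory C] {D : Type u₃} [Category.{u₄} D]

omit [GaloisCategory C] in
/-- The fibre functor intertwines the `Aut F`-actions on fibres (naturality).
[cite: MochizukiGeoAn2004, Def. 1.1.2(ii) p.10] -/
private theorem map_smul_aut'' (F : C ⥤ FintypeCat.{w}) {P X : C} (f : P ⟶ X) (σ : Aut F)
    (p : F.obj P) : F.map f (σ • p) = σ • F.map f p := by
  simp only [mulAction_def]
  exact (FunctorToFintypeCat.naturality F F σ.hom f p).symm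

/-- **Orbitwise approximation puts `s` in the image of `π₁`.**  Let `Φ : C ⥤ D` (`C` a Galois
category), `F_D` a functor on `D` to finite sets, `F_C` a basepoint of `C`, `e : Φ ⋙ F_D ≅ F_C`, and
`ι := Aut(e) ∘ π₁(Φ)`.  If `s ∈ Aut F_C` agrees on every point of every fibre with SOME element of the
image — `∀ X ξ, ∃ γ, ι(γ) · ξ = s · ξ` — then `s ∈ ι(Aut F_D)`: the image is compact hence closed, and the
stabilisers of points of (Galois) objects are a basis of neighbourhoods of `1`.
[cite: SGA1, Exp. V Cor. 5.7] -/
theorem mem_range_of_forall_exists_smul_eq (Φ : C ⥤ D) (FD : D ⥤ FintypeCat.{w})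
    (FC : C ⥤ FintypeCat.{w}) [FiberFunctor FC] (e : Φ ⋙ FD ≅ FC) (s : Aut FC)
    (h : ∀ (X : C) (ξ : FC.obj X), ∃ γ : Aut FD,
      (Aut.autMulEquivOfIso e) (pi1Map Φ FD γ) • ξ = s • ξ) :
    s ∈ ((Aut.autMulEquivOfIso e).toMonoidHom.comp (pi1Map Φ FD)).range := by
  let ι : Aut FD →* Aut FC := (Aut.autMulEquivOfIso e).toMonoidHom.comp (pi1Map Φ FD)
  have hcont : Continuous ι := (continuous_autMulEquivOfIso' e).comp (continuous_pi1Map' Φ FD)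
  have hclosed : IsClosed (Set.range ι) := (isCompact_range hcont).isClosed
  suffices hs : s ∈ Set.range ι by
    obtain ⟨γ, hγ⟩ := hs
    exact ⟨γ, hγ⟩
  rw [← hclosed.closure_eq, mem_closure_iff_nhds]
  intro t ht
  -- translate the neighbourhood of `s` to a neighbourhood of `1`
  have ht1 : (fun g : Aut FC => s * g) ⁻¹' t ∈ 𝓝 (1 : Aut FC) := by
    have hc : Continuous fun g : Aut FC => s * g := continuous_const_mul s
    have hca := hc.continuousAt (x := (1 : Aut FC))
    rw [ContinuousAt, mul_one] at hca
    exact hca ht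
  obtain ⟨P, -, hP⟩ := (nhds_one_has_basis_stabilizers FC).mem_iff.mp ht1
  obtain ⟨γ, hγ⟩ := h P.obj P.pt
  refine ⟨ι γ, ?_, γ, rfl⟩
  have hu : s⁻¹ * ι γ ∈ MulAction.stabilizer (Aut FC) P.pt := by
    rw [MulAction.mem_stabilizer_iff, mul_smul]
    change s⁻¹ • ((Aut.autMulEquivOfIso e) (pi1Map Φ FD γ) • P.pt) = P.pt
    rw [hγ, inv_smul_smul]
  have hmem := hP hu
  simpa only [Set.mem_preimage, mul_inv_cancel_left] using hmem

/-- **The stabiliser of a point lies in the image of `π₁` when the image acts transitively on the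
fibres over that point of all connected objects over it.**  With `Φ, F_D, F_C, e, ι` as in
`mem_range_of_forall_exists_smul_eq` and a point `x ∈ F_C(A)`: if for every connected `Y`, every
`g : Y ⟶ A` and all `y, y′ ∈ F_C(Y)` with `F_C(g) y = x = F_C(g) y′` some `γ` has `ι(γ) · y = y′`, then
`Stab_{Aut F_C}(x) ≤ ι(Aut F_D)`.  (For `s ∈ Stab(x)` and `ξ ∈ F_C(X)` apply the hypothesis to the
connected component of `X × A` through `(ξ, x)`, which also contains `s · (ξ, x) = (s · ξ, x)`:
components are orbits.) [cite: SGA1, Exp. V Cor. 5.7] -/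
theorem stabilizer_le_range_of_forall_connected (Φ : C ⥤ D) (FD : D ⥤ FintypeCat.{w})
    (FC : C ⥤ FintypeCat.{w}) [FiberFunctor FC] (e : Φ ⋙ FD ≅ FC) {A : C} (x : FC.obj A)
    (h : ∀ (Y : C) [IsConnected Y] (g : Y ⟶ A) (y y' : FC.obj Y),
      FC.map g y = x → FC.map g y' = x →
      ∃ γ : Aut FD, (Aut.autMulEquivOfIso e) (pi1Map Φ FD γ) • y = y') :
    MulAction.stabilizer (Aut FC) x ≤
      ((Aut.autMulEquivOfIso e).toMonoidHom.comp (pi1Map Φ FD)).range := by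
  intro s hs
  refine mem_range_of_forall_exists_smul_eq Φ FD FC e s fun X ξ => ?_
  -- the point `(ξ, x)` of `X × A` and the connected component through it
  let ω : FC.obj (X ⨯ A) := (fiberBinaryProductEquiv FC X A).symm (ξ, x)
  have hω1 : FC.map prod.fst ω = ξ := fiberBinaryProductEquiv_symm_fst_apply FC ξ x
  have hω2 : FC.map prod.snd ω = x := fiberBinaryProductEquiv_symm_snd_apply FC ξ x
  obtain ⟨P, p, hp⟩ := exists_component_mem_range FC ω
  haveI : IsConnected (P.1 : C) := P.2
  -- `s · ω` lies in the same component (components are orbits)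
  have hsω : s • ω ∈ Set.range (FC.map P.1.arrow) := by
    rw [range_map_arrow_eq_orbit FC P ⟨p, hp⟩]
    exact MulAction.mem_orbit ω s
  obtain ⟨p', hp'⟩ := hsω
  have hx1 : FC.map (P.1.arrow ≫ prod.snd) p = x := by
    rw [FC.map_comp, FintypeCat.comp_apply, hp, hω2]
  have hx2 : FC.map (P.1.arrow ≫ prod.snd) p' = x := by
    rw [FC.map_comp, FintypeCat.comp_apply, hp', map_smul_aut'', hω2]
    exact hs
  obtain ⟨γ, hγ⟩ := h P.1 (P.1.arrow ≫ prod.snd) p p' hx1 hx2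
  refine ⟨γ, ?_⟩
  have h1 : FC.map (P.1.arrow ≫ prod.fst) p = ξ := by
    rw [FC.map_comp, FintypeCat.comp_apply, hp, hω1]
  have h2 : FC.map (P.1.arrow ≫ prod.fst) p' = s • ξ := by
    rw [FC.map_comp, FintypeCat.comp_apply, hp', map_smul_aut'', hω1]
  have h3 := congrArg (FC.map (P.1.arrow ≫ prod.fst)) hγ
  rw [map_smul_aut'', h1, h2] at h3
  exact h3

end Criterion

end Literature.AnabelianGeometry.Anabelioids
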